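import Literature.NumberTheory.GaloisRepresentations.GalLayerSystemSES
import Literature.NumberTheory.GaloisRepresentations.GalLayerSystemHomLayers
import HarnessLib

/-!
# The limit sequence `0 → lim→ Eˣ → J̄ → C̄ → 0` on the layers IS the finite-layer sequence `0 → Eˣ → J_E → C_E → 0`
# of the cell (`ideleClassShortComplex F E`), and so on cohomology (Tate, C–F VII §8, §11.1)

Topic `NumberTheory/GaloisRepresentations`; namespace `Literature.NumberTheory.GaloisRepresentations`.  Sequel to
`GalLayerSystemSES.lean` (door-c5 g16: `unitsToIdele`, `ideleToClass`, `ideleClassLimitShortComplex_shortExact`) and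
`GalLayerSystemHomLayers.lean` (`functor_map_comp_layerCohomologyIso`), with the cell's `IdeleGaloisRep.lean`
(`principalRepHom`, `classRepHom`, `ideleClassShortComplex F E`, `ideleClassShortComplex_shortExact`).  Theorems only; NO
named fact, no `sorry`, no instance, no notation.  Route A of crux `AnticycControlAdditiveK` (item 19295).

Mathematics.  On every finite Galois layer `E` the morphisms of systems `unitsToIdele`, `ideleToClass` are, as morphisms of
`Rep ℤ Gal(E/F)`, the cell's `principalRepHom F E` and `classRepHom F E` (definitionally), so the layer short complex of the
limit sequence is `ideleClassShortComplex F E`; and under the layer cohomology isomorphisms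
`Hⁿ(Γ_F ⧸ U_E, (·)^{U_E}) ≅ Hⁿ(Gal(E/F), ·_E)` the maps induced by `lim→ Eˣ → J̄` and `J̄ → C̄` on door-c4's layers are
`Hⁿ(Gal(E/F), Eˣ → J_E)` and `Hⁿ(Gal(E/F), J_E → C_E)` — the long exact sequences of the layers (e.g. the cell's
`mono_H2_map_principalRepHom`, Brauer-to-idèle injectivity) are available on the layers of the limit objects
(Tate VII §11.1: the exact commutative diagram of the tower; §8).

## What is formalised (`F : Type` a number field)

* **`unitsToIdele_appRepHom`** (`= principalRepHom F E`), **`ideleToClass_appRepHom`** (`= classRepHom F E`),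
  **`layerShortComplex_eq`** (the layer short complex is `ideleClassShortComplex F E`), `layerShortComplex_shortExact`.
* **`functor_map_unitsToIdele_comp_layerCohomologyIso`**, **`functor_map_ideleToClass_comp_layerCohomologyIso`**
  (the cohomology squares with `principalRepHom` / `classRepHom`).

## References
* J. W. S. Cassels, A. Fröhlich (eds.), *Algebraic Number Theory* (1967), Ch. VII (J. Tate) §8, §11.1. [CasselsFrohlichANT1967]
-/

noncomputable section

open CategoryTheory CategoryTheory.Limits NumberField groupCohomology
open Field (absoluteGaloisGroup)
open Literature.Algebra.Homology
open Literature.NumberTheory.Automorphic Literature.NumberTheory.Automorphic.IdeleClassGroup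
open Literature.NumberTheory.NumberFields
open scoped Classical

namespace Literature.NumberTheory.GaloisRepresentations

open IdeleClassBar

variable (F : Type) [Field F] [NumberField F]

/-! ## The layer maps are the cell's `principalRepHom`, `classRepHom` -/

/-- **`unitsToIdele` on the layer `E` is the cell's `principalRepHom F E : Eˣ ⟶ J_E`** (definitionally).
[cite: CasselsFrohlichANT1967, Ch. VII §8] -/
theorem unitsToIdele_appRepHom (E : GalLayer F) :
    (unitsToIdele F).appRepHom E = (haveI := E.numberField; IdeleClassGroup.principalRepHom F E.1) := rfl

/-- **`ideleToClass` on the layer `E` is the cell's `classRepHom F E : J_E ⟶ C_E`** (definitionally).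
[cite: CasselsFrohlichANT1967, Ch. VII §8] -/
theorem ideleToClass_appRepHom (E : GalLayer F) :
    (ideleToClass F).appRepHom E = (haveI := E.numberField; IdeleClassGroup.classRepHom F E.1) := rfl

/-- **The layer short complex `Eˣ → J_E → C_E` of the limit sequence is the cell's `ideleClassShortComplex F E`.**
[cite: CasselsFrohlichANT1967, Ch. VII §8] -/
theorem layerShortComplex_eq (E : GalLayer F) :
    ShortComplex.mk ((unitsToIdele F).appRepHom E) ((ideleToClass F).appRepHom E)
        (Rep.hom_ext (Representation.IntertwiningMap.ext (LinearMap.ext fun x =>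
          ideleToClass_unitsToIdele F E x))) =
      (haveI := E.numberField; IdeleClassGroup.ideleClassShortComplex F E.1) := rfl

/-- The layer short complex is short exact (the cell's `ideleClassShortComplex_shortExact`).
[cite: CasselsFrohlichANT1967, Ch. VII §8] -/
theorem layerShortComplex_shortExact (E : GalLayer F) :
    (ShortComplex.mk ((unitsToIdele F).appRepHom E) ((ideleToClass F).appRepHom E)
        (Rep.hom_ext (Representation.IntertwiningMap.ext (LinearMap.ext fun x =>
          ideleToClass_unitsToIdele F E x)))).ShortExact := by
  rw [layerShortComplex_eq]
  haveI := E.numberField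
  exact IdeleClassGroup.ideleClassShortComplex_shortExact F E.1

/-! ## The cohomology squares -/

/-- **`Hⁿ(Γ_F ⧸ U_E, (lim→ Eˣ → J̄)^{U_E}) ≫ iso_J = iso_{Eˣ} ≫ Hⁿ(Gal(E/F), principalRepHom)`**: on door-c4's layers and
under the layer cohomology isomorphisms, the first map of the limit sequence induces `Hⁿ(Gal(E/F), Eˣ → J_E)`.
[cite: CasselsFrohlichANT1967, Ch. VII §11.1] -/
theorem functor_map_unitsToIdele_comp_layerCohomologyIso (E : GalLayer F) (n : ℕ) :
    (groupCohomology.functor ℤ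
          (absoluteGaloisGroup F ⧸ (E.openNormalSubgroup : Subgroup (absoluteGaloisGroup F))) n).map
        ((DiscreteRep.invariantsQuotFunctor ℤ (E.openNormalSubgroup : Subgroup (absoluteGaloisGroup F))).map
          (unitsToIdele F).limitHom) ≫ ((ideleData F).layerCohomologyIso E n).hom =
      ((unitsData F).layerCohomologyIso E n).hom ≫
        (groupCohomology.functor ℤ (E.1 ≃ₐ[F] E.1) n).map
          (haveI := E.numberField; IdeleClassGroup.principalRepHom F E.1) :=
  (unitsToIdele F).functor_map_comp_layerCohomologyIso E n

/-- **`Hⁿ(Γ_F ⧸ U_E, (J̄ → C̄)^{U_E}) ≫ iso_C = iso_J ≫ Hⁿ(Gal(E/F), classRepHom)`** (the target iso is g15's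
`layerCohomologyIso` for `C̄`, as `(classData F).layerCohomologyIso = IdeleClassBar.layerCohomologyIso` up to the
definitional identification `classData_toD`). [cite: CasselsFrohlichANT1967, Ch. VII §11.1] -/
theorem functor_map_ideleToClass_comp_layerCohomologyIso (E : GalLayer F) (n : ℕ) :
    (groupCohomology.functor ℤ
          (absoluteGaloisGroup F ⧸ (E.openNormalSubgroup : Subgroup (absoluteGaloisGroup F))) n).map
        ((DiscreteRep.invariantsQuotFunctor ℤ (E.openNormalSubgroup : Subgroup (absoluteGaloisGroup F))).map
          (ideleToClass F).limitHom) ≫ ((classData F).layerCohomologyIso E n).hom =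
      ((ideleData F).layerCohomologyIso E n).hom ≫
        (groupCohomology.functor ℤ (E.1 ≃ₐ[F] E.1) n).map
          (haveI := E.numberField; IdeleClassGroup.classRepHom F E.1) :=
  (ideleToClass F).functor_map_comp_layerCohomologyIso E n

/-- g15's layer cohomology isomorphism for `C̄` is the generic one for `classData` (definitionally).
[cite: CasselsFrohlichANT1967, Ch. VII §11.1] -/
theorem classData_layerCohomologyIso (E : GalLayer F) (n : ℕ) :
    (classData F).layerCohomologyIso E n = IdeleClassBar.layerCohomologyIso E n := rfl

end Literature.NumberTheory.GaloisRepresentations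

end
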